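import Literature.NumberTheory.EllipticCurves.HeathBrown1994.CongruentTwoSelmerMonskyFamilies
import Mathlib.LinearAlgebra.Matrix.NonsingularInverse
import HarnessLib

/-!
# Feng's odd-graph families through Monsky's matrix: `s(n) = 0` uniformly in the number of prime factors (§8)

Topic `NumberTheory/EllipticCurves`, namespace `Literature.NumberTheory.EllipticCurves.HeathBrown1994.Families`
(second continuation module of `HeathBrown1994/CongruentTwoSelmerMonskyMatrix.lean`).  Everything here is PROVED;
no definition, no named fact.

Feng, Acta Arith. 75 (1996), Thm. 3.1 (p. 78): "We have `S^{(φ)}(E_n) = {1}` and `S^{(φ̂)}(E'_n) = {±1, ±n}` in the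
following two cases (`p₁, …, p_t` are distinct odd prime numbers). (I) `n = p₁p₂⋯p_t` (`t ≥ 1`), `p₁ ≡ 3 (mod 8)`,
`pᵢ ≡ 1 (mod 8)` for `i ≥ 2`, and `G(n)` is an odd graph. (II) `n = 2p₁p₂⋯p_t` (`t ≥ 1`), `p₁ ≡ 5 (mod 8)`,
`pᵢ ≡ 1 (mod 8)` for `i ≥ 2`, and `G(n/2)` is an odd graph. Therefore rank `E_n(ℚ) = 0` so that `n` is a
non-congruent number, and the order of the Tate–Shafarevich group `Ш(E_n)` is odd."  Here `G(m)` is the graph on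
the prime factors of `m` with an arc `pᵢ → p_j` iff `(p_j/pᵢ) = −1` (p. 76), "non-directed by the quadratic
reciprocity law" in cases (I)/(II) (p. 78), and by Lemma 2.2 (p. 74) "`G` is an odd graph iff `r = m − 1`",
`r = rank_{𝔽₂} M(G)`, `M(G)` = diag(out-degrees) − adjacency.  Over `𝔽₂`, `M(G(m))` IS Monsky's block `A`
(`legendreMatrix`: off-diagonal entries `[(p_j/pᵢ) = −1]`, diagonal = row sums), and since `A·(1,…,1)ᵀ = 0`
always, "`rank A = t − 1`" says exactly that the kernel of `A` is `{0, (1,…,1)}` — the hypothesis `hG` below.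

WHAT IS PROVED (ours; a direct computation with Monsky's printed matrix, not Feng's `2`-descent): under the residue
conditions of (I) resp. (II) and `hG`, Monsky's matrix has `det M = 1` (`det_monskyMatrixOdd_eq_one_of_oddGraph`,
`det_monskyMatrixEven_eq_one_of_oddGraph`) — for EVERY `t`, uniformly.  Mechanism: `D₋₂ = 0` (resp. `D₋₁ = 0`),
`D₂ = E₁₁`, `A` symmetric with vanishing row and column sums; `M(x, y) = 0` forces `x₁ = y₁ = 0` (sum the
coordinates) and then `Ax = Ay = 0`, so `x, y ∈ {0, 1} ∩ {x₁ = 0} = {0}`.  With §6 of the main file this gives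
`BSD(E_n, ℓ)` for every prime `ℓ` on both families modulo the four named facts (Monsky; Burungale–Tian 2026;
Deuring–Hecke; Burungale–Flach 2024) — infinite families in every number of prime factors `t`.

## References

* [Feng1996NonCongruent] K. Feng, Acta Arith. 75 (1996) 71–83: §2 (graphs, Lemma 2.2 p. 74; `G(D)` p. 76),
  Thm. 3.1 (p. 78).
* [HeathBrown1994SelmerCongruentII] D. R. Heath-Brown (appendix by P. Monsky), Invent. Math. 118 (1994),
  Appendix pp. 39–41 (the matrix `M`, `s(D) = 2n − rank M`).
* [IrelandRosen1990] K. Ireland, M. Rosen, GTM 84, Ch. 5 §2 (Jacobi symbol; reciprocity Thm. 2).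
-/

open Matrix Finset Literature.NumberTheory.EllipticCurves Literature.NumberTheory.EllipticCurves.HeathBrown1994

namespace Literature.NumberTheory.EllipticCurves.HeathBrown1994.Families

variable {k : ℕ}

/-! ### §1. Monsky's block `A` (= Feng's `M(G)` over `𝔽₂`): entries, row sums, symmetry -/

/-- Off-diagonal entries of `A`: `a_ij = [(p_j/pᵢ) = −1]`. [cite: HeathBrown1994SelmerCongruentII, Appendix (Monsky), typescript p. 39 L10–L13] -/
theorem legendreMatrix_apply_of_ne (p : Fin k → ℕ) {i j : Fin k} (h : i ≠ j) :
    legendreMatrix p i j = addLegendreSym (p j) (p i) := by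
  simp [legendreMatrix, h]

/-- Diagonal entries of `A`: `a_ii = Σ_{j ≠ i} a_ij`. [cite: HeathBrown1994SelmerCongruentII, Appendix (Monsky), typescript p. 39 L10–L13] -/
theorem legendreMatrix_apply_self (p : Fin k → ℕ) (i : Fin k) :
    legendreMatrix p i i = ∑ j ∈ univ.erase i, legendreMatrix p i j := by
  rw [legendreMatrix, Matrix.of_apply, if_pos rfl]
  refine Finset.sum_congr rfl fun j hj => ?_
  rw [Matrix.of_apply, if_neg (Finset.ne_of_mem_erase hj).symm]

/-- **Row sums of `A` vanish**: `A·(1, …, 1)ᵀ = 0` (so `rank A ≤ t − 1`, Feng's "`r ≤ m − 1`").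
[cite: Feng1996NonCongruent, §2 before Lemma 2.2 (p. 74: r ≤ rank_ℚ M(G) ≤ m − 1)] -/
theorem legendreMatrix_mulVec_one (p : Fin k → ℕ) :
    legendreMatrix p *ᵥ (fun _ => (1 : ZMod 2)) = 0 := by
  ext i
  rw [Matrix.mulVec, Pi.zero_apply]
  change ∑ j, legendreMatrix p i j * 1 = 0
  simp_rw [mul_one]
  rw [← Finset.add_sum_erase _ _ (Finset.mem_univ i), ← legendreMatrix_apply_self]
  exact CharTwo.add_self_eq_zero _

/-- Reciprocity for the additive symbol: `[(a/b) = −1] = [(b/a) = −1]` when `a ≡ 1 (mod 4)`, `b` odd.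
[cite: IrelandRosen1990, Ch. 5 §2 Thm. 2 (reciprocity for the Jacobi symbol)] -/
theorem addLegendreSym_comm_of_mod_four_eq_one {a b : ℕ} (ha : a % 4 = 1) (hb : Odd b) :
    addLegendreSym (a : ℤ) b = addLegendreSym (b : ℤ) a := by
  rw [addLegendreSym_def, addLegendreSym_def, jacobiSym.quadratic_reciprocity_one_mod_four ha hb]

/-- **`A` is symmetric in Feng's cases** ("`G(n)` is non-directed by the quadratic reciprocity law"): all
primes odd and all but possibly `p₀` congruent to `1 (mod 4)`. [cite: Feng1996NonCongruent, proof of Thm. 3.1 (p. 78, first line)] -/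
theorem legendreMatrix_transpose_eq (p : Fin (k + 1) → ℕ) (hodd : ∀ i, Odd (p i))
    (h1 : ∀ i, i ≠ 0 → p i % 4 = 1) : (legendreMatrix p)ᵀ = legendreMatrix p := by
  ext i j
  rw [Matrix.transpose_apply]
  rcases eq_or_ne i j with rfl | hij
  · rfl
  rw [legendreMatrix_apply_of_ne p hij, legendreMatrix_apply_of_ne p hij.symm]
  -- goal: addLegendreSym (p i) (p j) = addLegendreSym (p j) (p i)
  rcases eq_or_ne i 0 with rfl | hi
  · exact (addLegendreSym_comm_of_mod_four_eq_one (h1 j hij.symm) (hodd 0)).symm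
  · exact addLegendreSym_comm_of_mod_four_eq_one (h1 i hi) (hodd j)

/-- Column sums vanish too when `A` is symmetric: `Σᵢ (A y)ᵢ = 0` for every `y`.
[cite: Feng1996NonCongruent, §2 Lemma 2.2 (p. 74)] -/
theorem sum_legendreMatrix_mulVec_eq_zero (p : Fin (k + 1) → ℕ)
    (hsymm : (legendreMatrix p)ᵀ = legendreMatrix p) (y : Fin (k + 1) → ZMod 2) :
    ∑ i, (legendreMatrix p *ᵥ y) i = 0 := by
  have h : (fun _ => (1 : ZMod 2)) ⬝ᵥ (legendreMatrix p *ᵥ y) = 0 := by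
    rw [Matrix.dotProduct_mulVec, ← Matrix.mulVec_transpose, hsymm, legendreMatrix_mulVec_one,
      zero_dotProduct]
  simpa [dotProduct] using h

/-- `−v = v` for vectors over `𝔽₂`. [cite: HeathBrown1994SelmerCongruentII, Appendix (Monsky), typescript p. 39 (arithmetic over ℤ/2)] -/
theorem neg_eq_self_pi {ι : Type*} (v : ι → ZMod 2) : -v = v :=
  funext fun i => ZMod.neg_eq_self_mod_two (v i)

/-! ### §2. The kernel argument -/

/-- **Feng's Lemma 2.2 in kernel form**: if `rank_{𝔽₂} A = t − 1` ("`G` is an odd graph iff `r = m − 1`") then the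
kernel of `A` is `{0, (1, …, 1)}` — the hypothesis `hG` of the theorems below. (`#ker A = 2^{t − rank A}` by
rank–nullity, `natCard_ker_mulVecLin_eq` of the main file.) [cite: Feng1996NonCongruent, §2 Lemma 2.2 (p. 74)] -/
theorem eq_zero_or_eq_one_of_rank_eq (p : Fin (k + 1) → ℕ) (hr : (legendreMatrix p).rank = k)
    (v : Fin (k + 1) → ZMod 2) (hv : legendreMatrix p *ᵥ v = 0) : v = 0 ∨ v = fun _ => 1 := by
  classical
  have hcard : Nat.card (LinearMap.ker (legendreMatrix p).mulVecLin) = 2 := by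
    rw [natCard_ker_mulVecLin_eq, Fintype.card_fin, hr, Nat.add_sub_cancel_left, pow_one]
  have mem : ∀ w, legendreMatrix p *ᵥ w = 0 → w ∈ LinearMap.ker (legendreMatrix p).mulVecLin :=
    fun w hw => by rw [LinearMap.mem_ker, Matrix.mulVecLin_apply]; exact hw
  obtain ⟨y, -, huniq⟩ := (Nat.card_eq_two_iff'
    (⟨0, mem 0 (Matrix.mulVec_zero _)⟩ : LinearMap.ker (legendreMatrix p).mulVecLin)).mp hcard
  by_cases h0 : v = 0
  · exact Or.inl h0
  · right
    have h1 : (⟨fun _ => 1, mem _ (legendreMatrix_mulVec_one p)⟩ :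
        LinearMap.ker (legendreMatrix p).mulVecLin) = y :=
      huniq _ (by
        intro h
        have h' := congr_arg Subtype.val h
        exact one_ne_zero (congr_fun h' 0))
    have h2 : (⟨v, mem v hv⟩ : LinearMap.ker (legendreMatrix p).mulVecLin) = y :=
      huniq _ (by
        intro h
        exact h0 (congr_arg Subtype.val h))
    exact congr_arg Subtype.val (h2.trans h1.symm)


/-- The matrix unit `E₁₁ = diag(1, 0, …, 0)`. [cite: HeathBrown1994SelmerCongruentII, Appendix (Monsky), typescript p. 39 L10–L13 (the diagonal matrices D_j)] -/
theorem diagonal_indicator_mulVec (w : Fin (k + 1) → ZMod 2) (i : Fin (k + 1)) :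
    ((Matrix.diagonal fun j : Fin (k + 1) => if j = 0 then (1 : ZMod 2) else 0) *ᵥ w) i =
      if i = 0 then w 0 else 0 := by
  rw [Matrix.mulVec_diagonal]
  split_ifs with h
  · subst h; simp
  · simp

/-- Core step: if `A x = E₁₁ w` with `A` of vanishing column sums, then `w₀ = 0` and `A x = 0`.
[cite: Feng1996NonCongruent, §2 Lemma 2.2 (p. 74)] -/
theorem mulVec_eq_zero_of_eq_indicator (p : Fin (k + 1) → ℕ)
    (hsymm : (legendreMatrix p)ᵀ = legendreMatrix p) {x w : Fin (k + 1) → ZMod 2}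
    (h : legendreMatrix p *ᵥ x =
      (Matrix.diagonal fun j : Fin (k + 1) => if j = 0 then (1 : ZMod 2) else 0) *ᵥ w) :
    w 0 = 0 ∧ legendreMatrix p *ᵥ x = 0 := by
  have hsum := sum_legendreMatrix_mulVec_eq_zero p hsymm x
  rw [h] at hsum
  simp_rw [diagonal_indicator_mulVec] at hsum
  rw [Finset.sum_ite_eq' Finset.univ (0 : Fin (k + 1)) (fun _ => w 0)] at hsum
  simp only [Finset.mem_univ, if_true] at hsum
  refine ⟨hsum, ?_⟩
  rw [h]
  ext i
  rw [diagonal_indicator_mulVec, Pi.zero_apply]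
  split_ifs <;> simp [hsum]

/-- If the kernel of `A` is `{0, (1, …, 1)}` ("`G` odd", Feng's Lemma 2.2) then a kernel vector with `x₀ = 0`
vanishes. [cite: Feng1996NonCongruent, §2 Lemma 2.2 (p. 74)] -/
theorem eq_zero_of_mulVec_eq_zero (p : Fin (k + 1) → ℕ)
    (hG : ∀ v, legendreMatrix p *ᵥ v = 0 → v = 0 ∨ v = fun _ => 1) {x : Fin (k + 1) → ZMod 2}
    (hx : legendreMatrix p *ᵥ x = 0) (hx0 : x 0 = 0) : x = 0 := by
  rcases hG x hx with h | h
  · exact h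
  · exfalso
    rw [h] at hx0
    exact one_ne_zero hx0

/-- Over `𝔽₂`, a square matrix whose only kernel vector is `0` has determinant `1`.
[cite: HeathBrown1994SelmerCongruentII, Appendix (Monsky), typescript p. 39 L33 (s(D) = 2n − rank M)] -/
theorem det_eq_one_of_ker_trivial {m : Type*} [Fintype m] [DecidableEq m] (M : Matrix m m (ZMod 2))
    (h : ∀ z, M *ᵥ z = 0 → z = 0) : M.det = 1 := by
  have hinj : Function.Injective M.mulVec := by
    intro a b hab
    have : M *ᵥ (a - b) = 0 := by rw [Matrix.mulVec_sub, hab, sub_self]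
    exact sub_eq_zero.mp (h _ this)
  have hU : IsUnit M.det := (Matrix.isUnit_iff_isUnit_det M).mp (Matrix.mulVec_injective_iff_isUnit.mp hinj)
  have hne : M.det ≠ 0 := hU.ne_zero
  have key : ∀ d : ZMod 2, d ≠ 0 → d = 1 := by decide
  exact key _ hne

/-! ### §3. Case (I): `n = p₀p₁⋯p_k`, `p₀ ≡ 3 (mod 8)`, `pᵢ ≡ 1 (mod 8)` (`i ≥ 1`), `G(n)` odd -/

section CaseOne

variable (p : Fin (k + 1) → ℕ)

/-- `D₂ = E₁₁` in case (I): `(2/p₀) = −1`, `(2/pᵢ) = +1`. [cite: IrelandRosen1990, Ch. 5 §2 Prop. 5.2.2] -/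
theorem legendreDiagonal_two_caseOne (h3 : p 0 % 8 = 3) (h1 : ∀ i, i ≠ 0 → p i % 8 = 1) :
    legendreDiagonal p 2 = Matrix.diagonal fun j : Fin (k + 1) => if j = 0 then (1 : ZMod 2) else 0 := by
  unfold legendreDiagonal
  congr 1
  ext j
  rcases eq_or_ne j 0 with rfl | hj
  · rw [if_pos rfl]; exact addLegendreSym_of_eq_neg_one (jacobiSym_two_eq_neg_one (Or.inl h3))
  · rw [if_neg hj]; exact addLegendreSym_of_eq_one (jacobiSym_two_eq_one (Or.inl (h1 j hj)))

/-- `D₋₂ = 0` in case (I): `(−2/p₀) = +1` (`p₀ ≡ 3 (mod 8)`), `(−2/pᵢ) = +1` (`pᵢ ≡ 1 (mod 8)`).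
[cite: IrelandRosen1990, Ch. 5 §2 Prop. 5.2.2] -/
theorem legendreDiagonal_neg_two_caseOne (h3 : p 0 % 8 = 3) (h1 : ∀ i, i ≠ 0 → p i % 8 = 1) :
    legendreDiagonal p (-2) = 0 := by
  unfold legendreDiagonal
  rw [← Matrix.diagonal_zero]
  congr 1
  ext j
  rcases eq_or_ne j 0 with rfl | hj
  · exact addLegendreSym_of_eq_one (jacobiSym_neg_two_eq_one (Or.inr h3))
  · exact addLegendreSym_of_eq_one (jacobiSym_neg_two_eq_one (Or.inl (h1 j hj)))

/-- **Case (I) of Feng's Thm. 3.1 through Monsky's matrix**: `det M = 1` (so `s(n) = 0`) for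
`n = p₀p₁⋯p_k` with `p₀ ≡ 3 (mod 8)`, `pᵢ ≡ 1 (mod 8)` (`i ≥ 1`) and `G(n)` odd (kernel of `A` = `{0, 1}`),
uniformly in `k`. [cite: Feng1996NonCongruent, Thm. 3.1 (I) (p. 78) with Lemma 2.2 (p. 74)] [cite: HeathBrown1994SelmerCongruentII, Appendix (Monsky), typescript p. 39 L27–L33 (the matrix; evaluation ours)] -/
theorem det_monskyMatrixOdd_eq_one_of_oddGraph (h3 : p 0 % 8 = 3)
    (h1 : ∀ i, i ≠ 0 → p i % 8 = 1)
    (hG : ∀ v, legendreMatrix p *ᵥ v = 0 → v = 0 ∨ v = fun _ => 1) :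
    (monskyMatrixOdd p).det = 1 := by
  have hodd : ∀ i, Odd (p i) := by
    intro i
    rcases eq_or_ne i 0 with rfl | hi
    · exact Nat.odd_iff.mpr (by omega)
    · have := h1 i hi; exact Nat.odd_iff.mpr (by omega)
  have hsymm := legendreMatrix_transpose_eq p hodd (fun i hi => by have := h1 i hi; omega)
  set E : Matrix (Fin (k + 1)) (Fin (k + 1)) (ZMod 2) :=
    Matrix.diagonal fun j : Fin (k + 1) => if j = 0 then (1 : ZMod 2) else 0 with hE
  have hD2 : legendreDiagonal p 2 = E := legendreDiagonal_two_caseOne p h3 h1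
  have hDm2 : legendreDiagonal p (-2) = 0 := legendreDiagonal_neg_two_caseOne p h3 h1
  apply det_eq_one_of_ker_trivial
  intro z hz
  -- split z into its two halves
  obtain ⟨x, y, rfl⟩ : ∃ x y, z = Sum.elim x y := ⟨z ∘ Sum.inl, z ∘ Sum.inr, (Sum.elim_comp_inl_inr z).symm⟩
  rw [monskyMatrixOdd, hD2, hDm2, add_zero, Matrix.fromBlocks_mulVec] at hz
  simp only [Sum.elim_comp_inl, Sum.elim_comp_inr] at hz
  have htop : (legendreMatrix p + E) *ᵥ x + E *ᵥ y = 0 := by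
    funext i; have := congr_fun hz (Sum.inl i); simpa only [Sum.elim_inl, Pi.zero_apply] using this
  have hbot : E *ᵥ x + legendreMatrix p *ᵥ y = 0 := by
    funext i; have := congr_fun hz (Sum.inr i); simpa only [Sum.elim_inr, Pi.zero_apply] using this
  -- bottom block: A y = E x (characteristic 2) ⇒ x₀ = 0 and A y = 0
  have hbot' : legendreMatrix p *ᵥ y = E *ᵥ x := by
    rw [eq_neg_of_add_eq_zero_right hbot, neg_eq_self_pi]
  obtain ⟨hx0, hAy⟩ := mulVec_eq_zero_of_eq_indicator p hsymm hbot'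
  -- top block: A x = E (x + y) ⇒ x₀ + y₀ = 0 and A x = 0
  have htop' : legendreMatrix p *ᵥ x = E *ᵥ (x + y) := by
    rw [Matrix.add_mulVec, add_assoc] at htop
    rw [eq_neg_of_add_eq_zero_left htop, neg_eq_self_pi, Matrix.mulVec_add]
  obtain ⟨hxy0, hAx⟩ := mulVec_eq_zero_of_eq_indicator p hsymm htop'
  have hy0 : y 0 = 0 := by
    have : x 0 + y 0 = 0 := hxy0
    rw [hx0, zero_add] at this
    exact this
  have hx : x = 0 := eq_zero_of_mulVec_eq_zero p hG hAx hx0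
  have hy : y = 0 := eq_zero_of_mulVec_eq_zero p hG hAy hy0
  subst hx hy
  funext i; cases i <;> rfl

/-- **`BSD(E_n, ℓ)` for every prime `ℓ` on Feng's family (I)** (`n = p₀⋯p_k`, `p₀ ≡ 3 (mod 8)`, `pᵢ ≡ 1 (mod 8)`,
`G(n)` odd), modulo Monsky's theorem and the journal facts BT26 / Deuring–Hecke / BF24 (§6 of the main file).
[cite: Feng1996NonCongruent, Thm. 3.1 (I) (p. 78)] [cite: BurungaleTian2026, Thm. 1.1 with Cor. 1.4] [cite: BurungaleFlach2024, Cor. 2] -/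
theorem forall_bsdp_of_oddGraph_odd (hM : monsky_card_selmerGroup_two_odd)
    (hBT : burungaleTian_analyticRank_eq_zero_of_selmerCorank_eq_zero_of_hasCM)
    (hH : hasEntireLFunction_of_j_mem_maximalCMJInvariants)
    (hBF : bsdTriple_of_hasCM_of_L_one_ne_zero) (hp : ∀ i, (p i).Prime) (hinj : Function.Injective p)
    (h3 : p 0 % 8 = 3) (h1 : ∀ i, i ≠ 0 → p i % 8 = 1)
    (hG : ∀ v, legendreMatrix p *ᵥ v = 0 → v = 0 ∨ v = fun _ => 1) (ℓ : ℕ) (hℓ : ℓ.Prime) :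
    haveI := isElliptic_congruentNumberCurve (n := ∏ i, p i)
      (Finset.prod_ne_zero_iff.mpr fun i _ => (hp i).ne_zero)
    haveI := isGloballyMinimal_congruentNumberCurve (n := ∏ i, p i) (squarefree_prod_of_injective p hp hinj)
    BSDp (congruentNumberCurve (∏ i, p i)) ℓ := by
  have hodd : ∀ i, Odd (p i) := by
    intro i
    rcases eq_or_ne i 0 with rfl | hi
    · exact Nat.odd_iff.mpr (by omega)
    · have := h1 i hi; exact Nat.odd_iff.mpr (by omega)
  exact forall_bsdp_of_monsky_of_BT_BF_odd p hM hBT hH hBF hp hodd hinj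
    (det_monskyMatrixOdd_eq_one_of_oddGraph p h3 h1 hG) ℓ hℓ

/-- Case (I) with Feng's hypothesis in RANK form (`rank_{𝔽₂} A = t − 1`, Lemma 2.2): `det M = 1`.
[cite: Feng1996NonCongruent, Thm. 3.1 (I) (p. 78) with Lemma 2.2 (p. 74)] -/
theorem det_monskyMatrixOdd_eq_one_of_rank_eq (h3 : p 0 % 8 = 3) (h1 : ∀ i, i ≠ 0 → p i % 8 = 1)
    (hr : (legendreMatrix p).rank = k) : (monskyMatrixOdd p).det = 1 :=
  det_monskyMatrixOdd_eq_one_of_oddGraph p h3 h1 (eq_zero_or_eq_one_of_rank_eq p hr)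

end CaseOne

/-! ### §4. Case (II): `n = 2p₀p₁⋯p_k`, `p₀ ≡ 5 (mod 8)`, `pᵢ ≡ 1 (mod 8)` (`i ≥ 1`), `G(n/2)` odd -/

section CaseTwo

variable (p : Fin (k + 1) → ℕ)

/-- `D₂ = E₁₁` in case (II): `(2/p₀) = −1` (`p₀ ≡ 5 (mod 8)`), `(2/pᵢ) = +1`. [cite: IrelandRosen1990, Ch. 5 §2 Prop. 5.2.2] -/
theorem legendreDiagonal_two_caseTwo (h5 : p 0 % 8 = 5) (h1 : ∀ i, i ≠ 0 → p i % 8 = 1) :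
    legendreDiagonal p 2 = Matrix.diagonal fun j : Fin (k + 1) => if j = 0 then (1 : ZMod 2) else 0 := by
  unfold legendreDiagonal
  congr 1
  ext j
  rcases eq_or_ne j 0 with rfl | hj
  · rw [if_pos rfl]; exact addLegendreSym_of_eq_neg_one (jacobiSym_two_eq_neg_one (Or.inr h5))
  · rw [if_neg hj]; exact addLegendreSym_of_eq_one (jacobiSym_two_eq_one (Or.inl (h1 j hj)))

/-- `D₋₁ = 0` in case (II): all primes are `≡ 1 (mod 4)`. [cite: IrelandRosen1990, Ch. 5 §2 Prop. 5.2.2] -/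
theorem legendreDiagonal_neg_one_caseTwo (h5 : p 0 % 8 = 5) (h1 : ∀ i, i ≠ 0 → p i % 8 = 1) :
    legendreDiagonal p (-1) = 0 := by
  unfold legendreDiagonal
  rw [← Matrix.diagonal_zero]
  congr 1
  ext j
  rcases eq_or_ne j 0 with rfl | hj
  · exact addLegendreSym_of_eq_one (jacobiSym_neg_one_eq_one (by omega))
  · exact addLegendreSym_of_eq_one (jacobiSym_neg_one_eq_one (by have := h1 j hj; omega))

/-- **Case (II) of Feng's Thm. 3.1 through Monsky's matrix**: `det M = 1` (so `s(n) = 0`) for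
`n = 2p₀p₁⋯p_k` with `p₀ ≡ 5 (mod 8)`, `pᵢ ≡ 1 (mod 8)` (`i ≥ 1`) and `G(n/2)` odd, uniformly in `k`.
[cite: Feng1996NonCongruent, Thm. 3.1 (II) (p. 78) with Lemma 2.2 (p. 74)] [cite: HeathBrown1994SelmerCongruentII, Appendix (Monsky), typescript p. 41 L20–L36 (the matrix; evaluation ours)] -/
theorem det_monskyMatrixEven_eq_one_of_oddGraph (h5 : p 0 % 8 = 5)
    (h1 : ∀ i, i ≠ 0 → p i % 8 = 1)
    (hG : ∀ v, legendreMatrix p *ᵥ v = 0 → v = 0 ∨ v = fun _ => 1) :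
    (monskyMatrixEven p).det = 1 := by
  have hodd : ∀ i, Odd (p i) := by
    intro i
    rcases eq_or_ne i 0 with rfl | hi
    · exact Nat.odd_iff.mpr (by omega)
    · have := h1 i hi; exact Nat.odd_iff.mpr (by omega)
  have hsymm := legendreMatrix_transpose_eq p hodd (fun i hi => by have := h1 i hi; omega)
  set E : Matrix (Fin (k + 1)) (Fin (k + 1)) (ZMod 2) :=
    Matrix.diagonal fun j : Fin (k + 1) => if j = 0 then (1 : ZMod 2) else 0 with hE
  have hD2 : legendreDiagonal p 2 = E := legendreDiagonal_two_caseTwo p h5 h1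
  have hDm1 : legendreDiagonal p (-1) = 0 := legendreDiagonal_neg_one_caseTwo p h5 h1
  apply det_eq_one_of_ker_trivial
  intro z hz
  obtain ⟨x, y, rfl⟩ : ∃ x y, z = Sum.elim x y := ⟨z ∘ Sum.inl, z ∘ Sum.inr, (Sum.elim_comp_inl_inr z).symm⟩
  rw [monskyMatrixEven, hsymm, hD2, hDm1, Matrix.fromBlocks_mulVec] at hz
  simp only [Sum.elim_comp_inl, Sum.elim_comp_inr, Matrix.zero_mulVec, add_zero] at hz
  have htop : (legendreMatrix p + E) *ᵥ x = 0 := by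
    funext i; have := congr_fun hz (Sum.inl i); simpa only [Sum.elim_inl, Pi.zero_apply] using this
  have hbot : E *ᵥ x + (legendreMatrix p + E) *ᵥ y = 0 := by
    funext i; have := congr_fun hz (Sum.inr i); simpa only [Sum.elim_inr, Pi.zero_apply] using this
  -- top block: A x = E x ⇒ x₀ = 0, A x = 0 ⇒ x = 0
  have htop' : legendreMatrix p *ᵥ x = E *ᵥ x := by
    rw [Matrix.add_mulVec] at htop
    rw [eq_neg_of_add_eq_zero_left htop, neg_eq_self_pi]
  obtain ⟨hx0, hAx⟩ := mulVec_eq_zero_of_eq_indicator p hsymm htop'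
  have hx : x = 0 := eq_zero_of_mulVec_eq_zero p hG hAx hx0
  subst hx
  -- bottom block: A y = E y ⇒ y₀ = 0, A y = 0 ⇒ y = 0
  have hbot' : legendreMatrix p *ᵥ y = E *ᵥ y := by
    rw [Matrix.mulVec_zero, zero_add, Matrix.add_mulVec] at hbot
    rw [eq_neg_of_add_eq_zero_left hbot, neg_eq_self_pi]
  obtain ⟨hy0, hAy⟩ := mulVec_eq_zero_of_eq_indicator p hsymm hbot'
  have hy : y = 0 := eq_zero_of_mulVec_eq_zero p hG hAy hy0
  subst hy
  funext i; cases i <;> rfl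

/-- **`BSD(E_n, ℓ)` for every prime `ℓ` on Feng's family (II)** (`n = 2p₀⋯p_k`, `p₀ ≡ 5 (mod 8)`,
`pᵢ ≡ 1 (mod 8)`, `G(n/2)` odd), modulo Monsky's theorem and BT26 / Deuring–Hecke / BF24.
[cite: Feng1996NonCongruent, Thm. 3.1 (II) (p. 78)] [cite: BurungaleTian2026, Thm. 1.1 with Cor. 1.4] [cite: BurungaleFlach2024, Cor. 2] -/
theorem forall_bsdp_of_oddGraph_even (hM : monsky_card_selmerGroup_two_even)
    (hBT : burungaleTian_analyticRank_eq_zero_of_selmerCorank_eq_zero_of_hasCM)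
    (hH : hasEntireLFunction_of_j_mem_maximalCMJInvariants)
    (hBF : bsdTriple_of_hasCM_of_L_one_ne_zero) (hp : ∀ i, (p i).Prime) (hinj : Function.Injective p)
    (h5 : p 0 % 8 = 5) (h1 : ∀ i, i ≠ 0 → p i % 8 = 1)
    (hG : ∀ v, legendreMatrix p *ᵥ v = 0 → v = 0 ∨ v = fun _ => 1) (ℓ : ℕ) (hℓ : ℓ.Prime) :
    haveI := isElliptic_congruentNumberCurve (n := 2 * ∏ i, p i)
      (Nat.mul_ne_zero two_ne_zero (Finset.prod_ne_zero_iff.mpr fun i _ => (hp i).ne_zero))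
    haveI := isGloballyMinimal_congruentNumberCurve (n := 2 * ∏ i, p i)
      (squarefree_two_mul_prod_of_injective p hp
        (fun i => by
          rcases eq_or_ne i 0 with rfl | hi
          · exact Nat.odd_iff.mpr (by omega)
          · have := h1 i hi; exact Nat.odd_iff.mpr (by omega)) hinj)
    BSDp (congruentNumberCurve (2 * ∏ i, p i)) ℓ := by
  have hodd : ∀ i, Odd (p i) := by
    intro i
    rcases eq_or_ne i 0 with rfl | hi
    · exact Nat.odd_iff.mpr (by omega)
    · have := h1 i hi; exact Nat.odd_iff.mpr (by omega)
  exact forall_bsdp_of_monsky_of_BT_BF_even p hM hBT hH hBF hp hodd hinj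
    (det_monskyMatrixEven_eq_one_of_oddGraph p h5 h1 hG) ℓ hℓ

/-- Case (II) with Feng's hypothesis in RANK form (`rank_{𝔽₂} A = t − 1`): `det M = 1`.
[cite: Feng1996NonCongruent, Thm. 3.1 (II) (p. 78) with Lemma 2.2 (p. 74)] -/
theorem det_monskyMatrixEven_eq_one_of_rank_eq (h5 : p 0 % 8 = 5) (h1 : ∀ i, i ≠ 0 → p i % 8 = 1)
    (hr : (legendreMatrix p).rank = k) : (monskyMatrixEven p).det = 1 :=
  det_monskyMatrixEven_eq_one_of_oddGraph p h5 h1 (eq_zero_or_eq_one_of_rank_eq p hr)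

end CaseTwo

end Literature.NumberTheory.EllipticCurves.HeathBrown1994.Families
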